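import Summits.BirchSwinnertonDyer.BirchSwinnertonDyer.Theorems.InertBadSignedBranchesInertBadAtThreeQuarticTorsionCoordinates
import HarnessLib

/-!
# `3`-integrality of the twisted `3`-torsion sums on prime-to-`3` torsion of `y² = x³ − x` (the table (R))

Summit `BirchSwinnertonDyer`, crux `InertBadAtThree` (stmt-BirchSwinnertonDyer-19225), line of record `rubin_e1_inert_three`
(registered stub `stub_neronIntegralThreeQuartic` v4 / `stub_plainOddNeronIntegralThreeQuartic` v5); sequel to
`…InertBadAtThreeQuarticTorsionSums` (P4) and `…InertBadAtThreeQuarticTorsionCoordinates` (P5). Pieces **P6a, P6b, P6c** of the stub plan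
`Cruxes/InertBadAtThree/STUB-PLAN-neronIntegralThreeQuartic-bsd-idea-18-g8.md` (= its §8 «stub_quarticTorsionSums» together with P4/P5),
width seat bsd-wall-cm-bed-w1 g7. `Λ = ℤi + ℤ`, `ϖ₀ = Γ(1/4)²/(2√(2π))`, `D(w) = 3℘⁴ − 6ϖ₀⁴℘² − ϖ₀⁸`.

* **`quarticSum_threeIntegral` (P6a), `quarticConjSum_threeIntegral` (P6b), `kappaSum_threeIntegral` (P6c)** — for `w ∉ Λ`,
  `n w ∈ Λ`, `3 ∤ n`: `∃ s ∈ ℕ, 3 ∤ s` with `s·Σ_v χ₄(3v)E₁*(w+v)/(ϖ₀·3^{3/4})`, resp. `s·Σ_v χ̄₄(3v)E₁*(w+v)/(ϖ₀·3^{1/4})`,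
  resp. `s·Σ_v κ(3v)E₁*(w+v)/(ϖ₀·√3)` an algebraic integer — the table (R) of memo EPSILON-RESOLVED §7 / STUB-PLAN §0: on
  prime-to-`3` torsion the three twisted sums have `3`-adic order `≥ 3/4`, `1/4`, `1/2` = the deficits `1 − k/4`, `k = v₃(D) = 1, 3, 2`.
  Proof: by the closed forms, in coordinates `s·S/(ϖ₀3^{3/4}) = n·c·(X² + n⁴)·Y·(s/δ')` with `X = n²x`, `Y = n³y` integral (P5),
  `δ' = n⁸D/ϖ₀⁸ = −n⁸ + 3(X⁴ − 2n⁴X²)` (currency lemma), `c = 12(√3−1)℘(1/3)/(ϖ₀²3^{3/4})` with `c⁴ = 1024`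
  (`quarticSum_constants_pow_four`); resp. `3X² − n⁴` and `c' = 4(3−√3)℘(1/3)/(ϖ₀²3^{1/4})`, `c'⁴ = 1024`; resp. the constant `16`.

HONEST FRAMING: nothing here proves the registered stub (which also needs the theta dictionary P1b, the periods P2 and the CRT assembly
P6 of the plan), the crux `InertBadAtThree`, any instance of F-es-18, or BSD. No definitions, no named facts; axioms standard.
-/

set_option linter.dupNamespace false

noncomputable section

open Complex PeriodPair Real Set Filter Polynomial
open scoped Real Topology PeriodPair ComplexConjugate

namespace Summit.BirchSwinnertonDyer.BirchSwinnertonDyer.Theorems.InertBadSignedBranchesInertBadAtThreeQuarticTorsionIntegrality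

open Literature.NumberTheory.EllipticCurves Literature.NumberTheory.EllipticCurves.GaussianLattice
open Summit.BirchSwinnertonDyer.BirchSwinnertonDyer.Theorems.InertBadSignedBranchesInertBadAtThreeQuarticTorsionSums
open Summit.BirchSwinnertonDyer.BirchSwinnertonDyer.Theorems.InertBadSignedBranchesInertBadAtThreeQuarticTorsionCoordinates

/-- `ϖ₀ ≠ 0` in `ℂ`. -/
private theorem varpi_ne_zero' : ((Real.Gamma (1 / 4) ^ 2 / (2 * Real.sqrt (2 * π)) : ℝ) : ℂ) ≠ 0 :=
  Complex.ofReal_ne_zero.mpr varpi_pos.ne'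

/-! ### P6a/P6b/P6c: the `3`-adic orders `3/4`, `1/4`, `1/2` of the three twisted sums -/

/-- Casts of naturals are integral over `ℤ`. -/
private theorem isIntegral_natCast' (m : ℕ) : IsIntegral ℤ (m : ℂ) := by
  simpa using isIntegral_algebraMap (R := ℤ) (A := ℂ) (x := (m : ℤ))

/-- `3 ∤ n` in `ℕ` gives `3 ∤ −n⁸` in `ℤ`. -/
private theorem not_three_dvd_neg_pow_eight {n : ℕ} (h3 : ¬ 3 ∣ n) : ¬ (3 : ℤ) ∣ -((n : ℤ) ^ 8) := by
  rw [dvd_neg]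
  intro h
  have h' : (3 : ℤ) ∣ (n : ℤ) := Int.prime_three.dvd_of_dvd_pow h
  exact h3 (by exact_mod_cast h')

/-- `(3^{3/4})⁴ = 27`, `3^{3/4} ≠ 0` (principal branch, positive real base). -/
private theorem cpow_three_quarters : ((3 : ℂ) ^ ((3 : ℂ) / 4)) ^ 4 = 27 ∧ (3 : ℂ) ^ ((3 : ℂ) / 4) ≠ 0 := by
  constructor
  · rw [← Complex.cpow_nat_mul, show ((4 : ℕ) : ℂ) * ((3 : ℂ) / 4) = ((3 : ℕ) : ℂ) by push_cast; ring,
      Complex.cpow_natCast]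
    norm_num
  · intro h
    have := (Complex.cpow_eq_zero_iff _ _).mp h
    norm_num at this

/-- `(3^{1/4})⁴ = 3`, `3^{1/4} ≠ 0`. -/
private theorem cpow_one_quarter : ((3 : ℂ) ^ ((1 : ℂ) / 4)) ^ 4 = 3 ∧ (3 : ℂ) ^ ((1 : ℂ) / 4) ≠ 0 := by
  constructor
  · rw [← Complex.cpow_nat_mul, show ((4 : ℕ) : ℂ) * ((1 : ℂ) / 4) = ((1 : ℕ) : ℂ) by push_cast; ring,
      Complex.cpow_natCast]
    norm_num
  · intro h
    have := (Complex.cpow_eq_zero_iff _ _).mp h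
    norm_num at this

/-- **P6a — the `k = 1` cell: `∑_v χ₄(3v)E₁*(w+v) / (ϖ₀ · 3^{3/4})` is `3`-integral on prime-to-`3` torsion.** For `w ∉ Λ`,
`n w ∈ Λ`, `3 ∤ n` there is `s ∈ ℕ`, `3 ∤ s`, with `s · S_{χ₄}(w)/(ϖ₀ 3^{3/4})` an algebraic integer. In coordinates
`s·S/(ϖ₀3^{3/4}) = n · c · (X² + n⁴) · Y · (s/δ')` with `X = n²℘(w)/ϖ₀²`, `Y = n³℘'(w)/(2ϖ₀³)` integral (P5),
`δ' = n⁸D(w)/ϖ₀⁸ = −n⁸ + 3(X⁴ − 2n⁴X²)` (currency lemma) and `c = 12(√3−1)℘(1/3)/(ϖ₀²3^{3/4})`, `c⁴ = 1024`. -/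
theorem quarticSum_threeIntegral {w : ℂ} {n : ℕ} (hw : w ∉ (ofUpperHalfPlane UpperHalfPlane.I).lattice) (hn : ((n : ℂ) * w) ∈ (ofUpperHalfPlane UpperHalfPlane.I).lattice)
    (h3 : ¬ 3 ∣ n) :
    ∃ s : ℕ, ¬ 3 ∣ s ∧
      IsIntegral ℤ ((s : ℂ) *
        (kroneckerE₁ (w + 1 / 3) + kroneckerE₁ (w - 1 / 3) -
          (kroneckerE₁ (w + I / 3) + kroneckerE₁ (w - I / 3)) -
          I * (kroneckerE₁ (w + (1 + I) / 3) + kroneckerE₁ (w - (1 + I) / 3)) +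
          I * (kroneckerE₁ (w + (1 - I) / 3) + kroneckerE₁ (w - (1 - I) / 3))) / (((Real.Gamma (1 / 4) ^ 2 / (2 * Real.sqrt (2 * π)) : ℝ) : ℂ) * (3 : ℂ) ^ ((3 : ℂ) / 4))) := by
  have hn0 : n ≠ 0 := by rintro rfl; exact h3 (dvd_zero 3)
  have h3w := three_mul_notMem hw hn h3
  have hD := threeDiv_ne_zero hw h3w
  obtain ⟨hX, hY⟩ := torsion_coord_isIntegral hw hn hn0
  rw [quarticSum_eq hw hD]
  set P := ℘[ofUpperHalfPlane UpperHalfPlane.I] w with hP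
  set Q := ℘'[ofUpperHalfPlane UpperHalfPlane.I] w with hQ
  set P₁ := ℘[ofUpperHalfPlane UpperHalfPlane.I] (1 / 3) with hP₁
  set ϖ : ℂ := ((Real.Gamma (1 / 4) ^ 2 / (2 * Real.sqrt (2 * π)) : ℝ) : ℂ) with hϖ
  set t : ℂ := (3 : ℂ) ^ ((3 : ℂ) / 4) with ht
  have hϖ0 : ϖ ≠ 0 := varpi_ne_zero'
  obtain ⟨ht4, ht0⟩ := cpow_three_quarters
  rw [← ht] at ht4 ht0
  have hnC : (n : ℂ) ≠ 0 := by exact_mod_cast hn0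
  set X : ℂ := (n : ℂ) ^ 2 * (P / ϖ ^ 2) with hXdef
  set Y : ℂ := (n : ℂ) ^ 3 * (Q / (2 * ϖ ^ 3)) with hYdef
  have hnI := isIntegral_natCast' n
  -- the currency lemma applied to `δ' = -n⁸ + 3(X⁴ - 2n⁴X²)`
  have ha : IsIntegral ℤ (X ^ 4 - 2 * (n : ℂ) ^ 4 * X ^ 2) :=
    (hX.pow 4).sub (((isIntegral_natCast' 2).mul (hnI.pow 4)).mul (hX.pow 2))
  obtain ⟨s, hs3, hsI⟩ := exists_not_three_dvd_isIntegral_div ha (not_three_dvd_neg_pow_eight h3)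
  refine ⟨s, hs3, ?_⟩
  have hδ' : (((-((n : ℤ) ^ 8) : ℤ) : ℂ) + 3 * (X ^ 4 - 2 * (n : ℂ) ^ 4 * X ^ 2)) =
      (n : ℂ) ^ 8 * (3 * P ^ 4 - 6 * ϖ ^ 4 * P ^ 2 - ϖ ^ 8) / ϖ ^ 8 := by
    rw [hXdef]; push_cast; field_simp; ring
  rw [hδ'] at hsI
  -- the constant
  set c : ℂ := 12 * ((Real.sqrt 3 : ℂ) - 1) * P₁ / (ϖ ^ 2 * t) with hc
  have hc4 : c ^ 4 = 1024 := by
    have h108 := quarticSum_constants_pow_four.1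
    rw [← hP₁, ← hϖ] at h108
    have : c = 4 * (3 * ((Real.sqrt 3 : ℂ) - 1) * P₁ / ϖ ^ 2) / t := by
      rw [hc]; field_simp; ring
    rw [this, div_pow, mul_pow, h108, ht4]; norm_num
  have hcI : IsIntegral ℤ c :=
    IsIntegral.of_pow (by norm_num : 0 < 4) (by rw [hc4]; exact isIntegral_natCast' 1024)
  have key : (s : ℂ) * (6 * ((Real.sqrt 3 : ℂ) - 1) * P₁ * (P ^ 2 + ϖ ^ 4) * Q /
        (3 * P ^ 4 - 6 * ϖ ^ 4 * P ^ 2 - ϖ ^ 8)) / (ϖ * t) =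
      (n : ℂ) * c * (X ^ 2 + (n : ℂ) ^ 4) * Y *
        ((s : ℂ) / ((n : ℂ) ^ 8 * (3 * P ^ 4 - 6 * ϖ ^ 4 * P ^ 2 - ϖ ^ 8) / ϖ ^ 8)) := by
    rw [hc, hXdef, hYdef]
    field_simp
    ring
  rw [key]
  exact (((hnI.mul hcI).mul ((hX.pow 2).add (hnI.pow 4))).mul hY).mul hsI

/-- **P6b — the `k = 3` cell: `∑_v χ̄₄(3v)E₁*(w+v) / (ϖ₀ · 3^{1/4})` is `3`-integral on prime-to-`3` torsion**
(`= n · c' · (3X² − n⁴) · Y · (s/δ')`, `c' = 4(3−√3)℘(1/3)/(ϖ₀²3^{1/4})`, `c'⁴ = 1024`). -/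
theorem quarticConjSum_threeIntegral {w : ℂ} {n : ℕ} (hw : w ∉ (ofUpperHalfPlane UpperHalfPlane.I).lattice) (hn : ((n : ℂ) * w) ∈ (ofUpperHalfPlane UpperHalfPlane.I).lattice)
    (h3 : ¬ 3 ∣ n) :
    ∃ s : ℕ, ¬ 3 ∣ s ∧
      IsIntegral ℤ ((s : ℂ) *
        (kroneckerE₁ (w + 1 / 3) + kroneckerE₁ (w - 1 / 3) -
          (kroneckerE₁ (w + I / 3) + kroneckerE₁ (w - I / 3)) +
          I * (kroneckerE₁ (w + (1 + I) / 3) + kroneckerE₁ (w - (1 + I) / 3)) -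
          I * (kroneckerE₁ (w + (1 - I) / 3) + kroneckerE₁ (w - (1 - I) / 3))) / (((Real.Gamma (1 / 4) ^ 2 / (2 * Real.sqrt (2 * π)) : ℝ) : ℂ) * (3 : ℂ) ^ ((1 : ℂ) / 4))) := by
  have hn0 : n ≠ 0 := by rintro rfl; exact h3 (dvd_zero 3)
  have h3w := three_mul_notMem hw hn h3
  have hD := threeDiv_ne_zero hw h3w
  obtain ⟨hX, hY⟩ := torsion_coord_isIntegral hw hn hn0
  rw [quarticConjSum_eq hw hD]
  set P := ℘[ofUpperHalfPlane UpperHalfPlane.I] w with hP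
  set Q := ℘'[ofUpperHalfPlane UpperHalfPlane.I] w with hQ
  set P₁ := ℘[ofUpperHalfPlane UpperHalfPlane.I] (1 / 3) with hP₁
  set ϖ : ℂ := ((Real.Gamma (1 / 4) ^ 2 / (2 * Real.sqrt (2 * π)) : ℝ) : ℂ) with hϖ
  set t : ℂ := (3 : ℂ) ^ ((1 : ℂ) / 4) with ht
  have hϖ0 : ϖ ≠ 0 := varpi_ne_zero'
  obtain ⟨ht4, ht0⟩ := cpow_one_quarter
  rw [← ht] at ht4 ht0
  have hnC : (n : ℂ) ≠ 0 := by exact_mod_cast hn0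
  set X : ℂ := (n : ℂ) ^ 2 * (P / ϖ ^ 2) with hXdef
  set Y : ℂ := (n : ℂ) ^ 3 * (Q / (2 * ϖ ^ 3)) with hYdef
  have hnI := isIntegral_natCast' n
  have ha : IsIntegral ℤ (X ^ 4 - 2 * (n : ℂ) ^ 4 * X ^ 2) :=
    (hX.pow 4).sub (((isIntegral_natCast' 2).mul (hnI.pow 4)).mul (hX.pow 2))
  obtain ⟨s, hs3, hsI⟩ := exists_not_three_dvd_isIntegral_div ha (not_three_dvd_neg_pow_eight h3)
  refine ⟨s, hs3, ?_⟩
  have hδ' : (((-((n : ℤ) ^ 8) : ℤ) : ℂ) + 3 * (X ^ 4 - 2 * (n : ℂ) ^ 4 * X ^ 2)) =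
      (n : ℂ) ^ 8 * (3 * P ^ 4 - 6 * ϖ ^ 4 * P ^ 2 - ϖ ^ 8) / ϖ ^ 8 := by
    rw [hXdef]; push_cast; field_simp; ring
  rw [hδ'] at hsI
  set c : ℂ := 4 * (3 - (Real.sqrt 3 : ℂ)) * P₁ / (ϖ ^ 2 * t) with hc
  have hc4 : c ^ 4 = 1024 := by
    have h12 := quarticSum_constants_pow_four.2
    rw [← hP₁, ← hϖ] at h12
    have : c = 4 * ((3 - (Real.sqrt 3 : ℂ)) * P₁ / ϖ ^ 2) / t := by
      rw [hc]; field_simp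
    rw [this, div_pow, mul_pow, h12, ht4]; norm_num
  have hcI : IsIntegral ℤ c :=
    IsIntegral.of_pow (by norm_num : 0 < 4) (by rw [hc4]; exact isIntegral_natCast' 1024)
  have key : (s : ℂ) * (2 * (3 - (Real.sqrt 3 : ℂ)) * P₁ * (3 * P ^ 2 - ϖ ^ 4) * Q /
        (3 * P ^ 4 - 6 * ϖ ^ 4 * P ^ 2 - ϖ ^ 8)) / (ϖ * t) =
      (n : ℂ) * c * (3 * X ^ 2 - (n : ℂ) ^ 4) * Y *
        ((s : ℂ) / ((n : ℂ) ^ 8 * (3 * P ^ 4 - 6 * ϖ ^ 4 * P ^ 2 - ϖ ^ 8) / ϖ ^ 8)) := by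
    rw [hc, hXdef, hYdef]
    field_simp
    ring
  rw [key]
  exact (((hnI.mul hcI).mul (((isIntegral_natCast' 3).mul (hX.pow 2)).sub (hnI.pow 4))).mul hY).mul hsI

/-- **P6c — the `k = 2` cell: `∑_v κ(3v)E₁*(w+v) / (ϖ₀ · √3)` is `3`-integral on prime-to-`3` torsion**
(`GaussianLattice.kroneckerE₁_twisted_three_torsion_sum`: `S_κ = 8√3ϖ₀⁴℘℘'/D`; `s·S_κ/(ϖ₀√3) = 16 · n³ · X · Y · (s/δ')`). -/
theorem kappaSum_threeIntegral {w : ℂ} {n : ℕ} (hw : w ∉ (ofUpperHalfPlane UpperHalfPlane.I).lattice) (hn : ((n : ℂ) * w) ∈ (ofUpperHalfPlane UpperHalfPlane.I).lattice)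
    (h3 : ¬ 3 ∣ n) :
    ∃ s : ℕ, ¬ 3 ∣ s ∧
      IsIntegral ℤ ((s : ℂ) * threeTorsionTwistedSum w / (((Real.Gamma (1 / 4) ^ 2 / (2 * Real.sqrt (2 * π)) : ℝ) : ℂ) * (Real.sqrt 3 : ℂ))) := by
  have hn0 : n ≠ 0 := by rintro rfl; exact h3 (dvd_zero 3)
  have h3w := three_mul_notMem hw hn h3
  have hD := threeDiv_ne_zero hw h3w
  obtain ⟨hX, hY⟩ := torsion_coord_isIntegral hw hn hn0
  rw [kroneckerE₁_twisted_three_torsion_sum hw hD]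
  set P := ℘[ofUpperHalfPlane UpperHalfPlane.I] w with hP
  set Q := ℘'[ofUpperHalfPlane UpperHalfPlane.I] w with hQ
  set ϖ : ℂ := ((Real.Gamma (1 / 4) ^ 2 / (2 * Real.sqrt (2 * π)) : ℝ) : ℂ) with hϖ
  set r : ℂ := (Real.sqrt 3 : ℂ) with hr
  have hϖ0 : ϖ ≠ 0 := varpi_ne_zero'
  have hr0 : r ≠ 0 := by rw [hr, Complex.ofReal_ne_zero]; positivity
  have hnC : (n : ℂ) ≠ 0 := by exact_mod_cast hn0
  set X : ℂ := (n : ℂ) ^ 2 * (P / ϖ ^ 2) with hXdef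
  set Y : ℂ := (n : ℂ) ^ 3 * (Q / (2 * ϖ ^ 3)) with hYdef
  have hnI := isIntegral_natCast' n
  have ha : IsIntegral ℤ (X ^ 4 - 2 * (n : ℂ) ^ 4 * X ^ 2) :=
    (hX.pow 4).sub (((isIntegral_natCast' 2).mul (hnI.pow 4)).mul (hX.pow 2))
  obtain ⟨s, hs3, hsI⟩ := exists_not_three_dvd_isIntegral_div ha (not_three_dvd_neg_pow_eight h3)
  refine ⟨s, hs3, ?_⟩
  have hδ' : (((-((n : ℤ) ^ 8) : ℤ) : ℂ) + 3 * (X ^ 4 - 2 * (n : ℂ) ^ 4 * X ^ 2)) =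
      (n : ℂ) ^ 8 * (3 * P ^ 4 - 6 * ϖ ^ 4 * P ^ 2 - ϖ ^ 8) / ϖ ^ 8 := by
    rw [hXdef]; push_cast; field_simp; ring
  rw [hδ'] at hsI
  have key : (s : ℂ) * (8 * r * ϖ ^ 4 * P * Q / (3 * P ^ 4 - 6 * ϖ ^ 4 * P ^ 2 - ϖ ^ 8)) / (ϖ * r) =
      16 * (n : ℂ) ^ 3 * X * Y *
        ((s : ℂ) / ((n : ℂ) ^ 8 * (3 * P ^ 4 - 6 * ϖ ^ 4 * P ^ 2 - ϖ ^ 8) / ϖ ^ 8)) := by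
    rw [hXdef, hYdef]
    field_simp
    ring
  rw [key]
  exact ((((isIntegral_natCast' 16).mul (hnI.pow 3)).mul hX).mul hY).mul hsI

end Summit.BirchSwinnertonDyer.BirchSwinnertonDyer.Theorems.InertBadSignedBranchesInertBadAtThreeQuarticTorsionIntegrality
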